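import Literature.Geometry.Lorentzian.ExteriorTailHolderSpaces
import Mathlib.Analysis.SpecialFunctions.Pow.Deriv
import Mathlib.Analysis.SpecialFunctions.Trigonometric.Deriv
import Mathlib.Analysis.Calculus.Deriv.Mul
import Mathlib.Analysis.Calculus.FDeriv.Add
import Mathlib.Analysis.Calculus.FDeriv.Mul
import Mathlib.Analysis.Calculus.MeanValue
import HarnessLib

/-!
# Derivative decay from the logarithmic definition (Ellithy 2026, Lemma 3.3)

A. Ellithy, *The spacetime Penrose inequality under a quasi final state hypothesis*,
arXiv:2605.18730 (2026), §3.1, Lemma 3.3 (p. 20), for the parabolic Hölder spaces of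
Definitions 3.1/3.2 as typed in `Literature.Geometry.Lorentzian.ExteriorTailHolderSpaces`
(`ctNorm`, `ctWeightedNorm`, `tailSupNorm`, `tailHolderSeminorm`, `angPart`, `sDeriv`, `rpowWeight`;
that module's docstring lists Lemma 3.3 under "NOT here").

**Lemma 3.3** (p. 20): "Let `σ ∈ ℝ` and `v ∈ C^{2+α,1+α/2}_{-σ}(M)`. Then
`r^σ v, r^σ D̸v, r^σ D̸²v ∈ C⁰(M)`, `r^{σ+1} v_r ∈ C⁰(M)`, and likewise at the Hölder level,
`r^σ D̸²v ∈ C^{α,α/2}(M)`, `r^{σ+1} v_r ∈ C^{α,α/2}(M)`.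
*Proof.* By definition, `r^σ v ∈ C^{2+α,1+α/2}(M)`, so `(r^σ v)_s ∈ C⁰(M)` and `[(r^σ v)_s]_{α,α/2;M} < ∞`.
Using `(r^σ v)_s = -σ r^σ v + r^σ v_s`, `v_s = -r v_r`, we obtain
`-r^{σ+1} v_r = r^σ v_s = (r^σ v)_s + σ r^σ v`, which is bounded and Hölder whenever `r^σ v` and
`(r^σ v)_s` are. The tangential statements follow from `r^σ D̸^k v = D̸^k (r^σ v)`, `k = 1, 2`, because
`r^σ` is constant on each sphere `S_r`."

This module PROVES, for a `W`-valued `v` on a tail `J × S²` with `‖v‖_{C^{2+α,1+α/2}_{-σ}(M_J)} < ∞`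
(`ctWeightedNorm α σ J v < ⊤`):

* `sphereCovDeriv_const_smul`, `angPart_rpowWeight` — "`r^σ D̸^k v = D̸^k (r^σ v)` because `r^σ` is
  constant on each sphere" (all `k`, unconditionally);
* `tailSupNorm_rpowWeight_lt_top`, `tailSupNorm_rpowWeight_angPart_lt_top` (`k = 1, 2`),
  `tailHolderSeminorm_rpowWeight_angPart_two_lt_top` — `r^σ v, r^σ D̸v, r^σ D̸²v ∈ C⁰`,
  `r^σ D̸²v ∈ C^{α,α/2}`;
* `rpowWeight_rDeriv_eq` — the identity `r^{σ+1} v_r = -(r^σ v)_s - σ r^σ v` on `J ⊆ (0, ∞)`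
  (`rDeriv v = v_r`, `sDeriv w = w_s = -r w_r`), and `tailSupNorm_rpowWeight_rDeriv_le` /
  `tailSupNorm_rpowWeight_rDeriv_lt_top` — `‖r^{σ+1} v_r‖_{C⁰} ≤ ‖(r^σ v)_s‖_{C⁰} + |σ| ‖r^σ v‖_{C⁰} < ∞`;
* `derivDecay_of_ctWeightedNorm_lt_top` — the four `C⁰` clauses and the tangential Hölder clause
  of Lemma 3.3 in one statement;
* the last Hölder clause `r^{σ+1} v_r ∈ C^{α,α/2}(M)`.  The printed proof derives it from
  "`(r^σ v)_s + σ r^σ v` is Hölder whenever `r^σ v` and `(r^σ v)_s` are"; the Hölder seminorm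
  `[r^σ v]_{α,α/2}` of the function itself is not a summand of the `C^{2+α,1+α/2}` norm of Def. 3.1, it
  follows from the `C⁰` bounds on `D̸(r^σ v)` and `(r^σ v)_s` by the mean value inequality along great
  circles (`greatCircle`, `norm_sub_le_mul_angle`: `‖f(p') - f(p)‖ ≤ ‖D̸f‖_{C⁰} d_{γ_{S²}}(p, p')` for
  non-antipodal `p, p'`) and along radial segments in `s = -log r` (`norm_sub_le_mul_abs_log_sub`):
  `tailHolderSeminorm_le_interpolation` — `[w]_{α,α/2} ≤ ‖D̸w‖_{C⁰} + ‖w_s‖_{C⁰} + 2‖w‖_{C⁰}` on an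
  interval tail `J ⊆ (0, ∞)` for `0 < α ≤ 1` (pairs at parabolic distance `≥ 1` — in particular all
  antipodal pairs — are controlled by `2‖w‖_{C⁰}`); then `tailHolderSeminorm_rpowWeight_rDeriv_le`
  (`[r^{σ+1} v_r]_{α,α/2} ≤ [(r^σ v)_s]_{α,α/2} + |σ| [r^σ v]_{α,α/2}`),
  `tailHolderSeminorm_rpowWeight_rDeriv_lt_top`, `czNorm_rpowWeight_rDeriv_lt_top`,
  `czNorm_rpowWeight_lt_top` (`r^σ v ∈ C^{α,α/2}`), and `lemma33_of_ctWeightedNorm_lt_top` /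
  `lemma33_Ioi` — all six clauses of Lemma 3.3 (interval tail `J ⊆ (0, ∞)`, resp. the fixed open tails
  `(r₁, ∞)`, `r₁ ≥ 0`, of Defs. 3.6–3.29; `0 < α ≤ 1`, the print's `α ∈ (0, 1)`).

## References

* [Ellithy2026] A. Ellithy, arXiv:2605.18730 (2026), §3.1, Lemma 3.3 and Definitions 3.1, 3.2
  (p. 20).
-/

noncomputable section

open Set Metric Function Filter
open scoped ENNReal NNReal Topology RealInnerProductSpace

namespace Literature.Geometry.Lorentzian

variable {W : Type*} [NormedAddCommGroup W] [NormedSpace ℝ W]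

/-! ### `r^σ` is constant on spheres: `D̸^k (c • f) = c • D̸^k f` -/

/-- **`D̸^k (c f) = c D̸^k f` for a constant `c`** (the step "`r^σ D̸^k v = D̸^k (r^σ v)` because
`r^σ` is constant on each sphere `S_r`" of the proof of Lemma 3.3, Ellithy 2026, p. 20); holds for
every `k` and unconditionally (both sides carry the same junk where a stage is not differentiable,
`fderiv_const_smul_field`). [cite: Ellithy2026, Lemma 3.3 p. 20] -/
theorem sphereCovDeriv_const_smul (k : ℕ) (c : ℝ) (f : sphere (0 : E3) 1 → W)
    (p : sphere (0 : E3) 1) :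
    sphereCovDeriv k (fun q ↦ c • f q) p = c • sphereCovDeriv k f p := by
  induction k generalizing p with
  | zero =>
      ext m
      simp [sphereCovDeriv_zero_apply]
  | succ k ih =>
      have hfun : (fun y : E3 ↦ sphereCovDeriv k (fun q ↦ c • f q) (raySphere y)) =
          c • (fun y : E3 ↦ sphereCovDeriv k f (raySphere y)) := by
        funext y
        simp only [Pi.smul_apply, ih]
      have hderiv : fderiv ℝ (fun y : E3 ↦ sphereCovDeriv k (fun q ↦ c • f q) (raySphere y)) (p : E3) =
          c • fderiv ℝ (fun y : E3 ↦ sphereCovDeriv k f (raySphere y)) (p : E3) := by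
        rw [hfun]
        exact congrFun (fderiv_const_smul_field (𝕜 := ℝ)
          (f := fun y : E3 ↦ sphereCovDeriv k f (raySphere y)) c) _
      ext m
      rw [sphereCovDeriv_succ_apply, smul_apply, sphereCovDeriv_succ_apply, hderiv, smul_apply,
        smul_apply]

/-- **`D̸^k (r^σ v) = r^σ D̸^k v` on the tail** (Ellithy 2026, proof of Lemma 3.3, p. 20: "`r^σ` is
constant on each sphere"). [cite: Ellithy2026, Lemma 3.3 p. 20] -/
theorem angPart_rpowWeight (k : ℕ) (σ : ℝ) (v : ℝ → sphere (0 : E3) 1 → W) :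
    angPart k (rpowWeight σ v) = rpowWeight σ (angPart k v) := by
  funext r p
  exact sphereCovDeriv_const_smul k (r ^ σ) (v r) p

/-! ### The summands of the `C^{2+α,1+α/2}` norm (Def. 3.1) -/

section Summands

variable (α : ℝ) (J : Set ℝ) (w : ℝ → sphere (0 : E3) 1 → W)

/-- `‖D̸w‖_{C⁰} ≤ ‖w‖_{C^{2+α,1+α/2}}` (a summand of Def. 3.1, p. 20).
[cite: Ellithy2026, Def. 3.1 p. 20] -/
theorem tailSupNorm_angPart_one_le_ctNorm : tailSupNorm J (angPart 1 w) ≤ ctNorm α J w := by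
  by_cases h : CtRegularOn J w
  · simp only [ctNorm, h, if_true]
    exact le_add_right (le_add_right (le_add_right (le_add_right (le_add_left le_rfl))))
  · simp [ctNorm, h]

/-- `‖D̸²w‖_{C⁰} ≤ ‖w‖_{C^{2+α,1+α/2}}` (a summand of Def. 3.1, p. 20).
[cite: Ellithy2026, Def. 3.1 p. 20] -/
theorem tailSupNorm_angPart_two_le_ctNorm : tailSupNorm J (angPart 2 w) ≤ ctNorm α J w := by
  by_cases h : CtRegularOn J w
  · simp only [ctNorm, h, if_true]
    exact le_add_right (le_add_right (le_add_right (le_add_left le_rfl)))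
  · simp [ctNorm, h]

/-- `‖w_s‖_{C⁰} ≤ ‖w‖_{C^{2+α,1+α/2}}` (a summand of Def. 3.1, p. 20).
[cite: Ellithy2026, Def. 3.1 p. 20] -/
theorem tailSupNorm_sDeriv_le_ctNorm : tailSupNorm J (sDeriv w) ≤ ctNorm α J w := by
  by_cases h : CtRegularOn J w
  · simp only [ctNorm, h, if_true]
    exact le_add_right (le_add_right (le_add_left le_rfl))
  · simp [ctNorm, h]

/-- `[D̸²w]_{α,α/2} ≤ ‖w‖_{C^{2+α,1+α/2}}` (a summand of Def. 3.1, p. 20).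
[cite: Ellithy2026, Def. 3.1 p. 20] -/
theorem tailHolderSeminorm_angPart_two_le_ctNorm :
    tailHolderSeminorm α J (angPart 2 w) ≤ ctNorm α J w := by
  by_cases h : CtRegularOn J w
  · simp only [ctNorm, h, if_true]
    exact le_add_right (le_add_left le_rfl)
  · simp [ctNorm, h]

/-- `[w_s]_{α,α/2} ≤ ‖w‖_{C^{2+α,1+α/2}}` (a summand of Def. 3.1, p. 20).
[cite: Ellithy2026, Def. 3.1 p. 20] -/
theorem tailHolderSeminorm_sDeriv_le_ctNorm : tailHolderSeminorm α J (sDeriv w) ≤ ctNorm α J w := by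
  by_cases h : CtRegularOn J w
  · simp only [ctNorm, h, if_true]
    exact le_add_left le_rfl
  · simp [ctNorm, h]

end Summands

/-! ### Lemma 3.3: the `C⁰` clauses for `r^σ v`, `r^σ D̸v`, `r^σ D̸²v` and the tangential Hölder clause -/

section Tangential

variable {α σ : ℝ} {J : Set ℝ} {v : ℝ → sphere (0 : E3) 1 → W}

/-- **Lemma 3.3, `r^σ v ∈ C⁰(M)`** (Ellithy 2026, p. 20). [cite: Ellithy2026, Lemma 3.3 p. 20] -/
theorem tailSupNorm_rpowWeight_lt_top (h : ctWeightedNorm α σ J v < ⊤) :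
    tailSupNorm J (rpowWeight σ v) < ⊤ :=
  lt_of_le_of_lt (tailSupNorm_le_ctNorm α J _) h

/-- **Lemma 3.3, `r^σ D̸v ∈ C⁰(M)`** (Ellithy 2026, p. 20: `r^σ D̸v = D̸(r^σ v)`).
[cite: Ellithy2026, Lemma 3.3 p. 20] -/
theorem tailSupNorm_rpowWeight_angPart_one_lt_top (h : ctWeightedNorm α σ J v < ⊤) :
    tailSupNorm J (rpowWeight σ (angPart 1 v)) < ⊤ := by
  rw [← angPart_rpowWeight]
  exact lt_of_le_of_lt (tailSupNorm_angPart_one_le_ctNorm α J _) h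

/-- **Lemma 3.3, `r^σ D̸²v ∈ C⁰(M)`** (Ellithy 2026, p. 20: `r^σ D̸²v = D̸²(r^σ v)`).
[cite: Ellithy2026, Lemma 3.3 p. 20] -/
theorem tailSupNorm_rpowWeight_angPart_two_lt_top (h : ctWeightedNorm α σ J v < ⊤) :
    tailSupNorm J (rpowWeight σ (angPart 2 v)) < ⊤ := by
  rw [← angPart_rpowWeight]
  exact lt_of_le_of_lt (tailSupNorm_angPart_two_le_ctNorm α J _) h

/-- **Lemma 3.3, Hölder level, `r^σ D̸²v ∈ C^{α,α/2}(M)`** (Ellithy 2026, p. 20).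
[cite: Ellithy2026, Lemma 3.3 p. 20] -/
theorem tailHolderSeminorm_rpowWeight_angPart_two_lt_top (h : ctWeightedNorm α σ J v < ⊤) :
    tailHolderSeminorm α J (rpowWeight σ (angPart 2 v)) < ⊤ := by
  rw [← angPart_rpowWeight]
  exact lt_of_le_of_lt (tailHolderSeminorm_angPart_two_le_ctNorm α J _) h

/-- With the `C⁰` norm: `‖r^σ D̸²v‖_{C^{α,α/2}(M)} < ∞` (`czNorm` = `C⁰` + seminorm, Def. 3.1).
[cite: Ellithy2026, Lemma 3.3 p. 20] -/
theorem czNorm_rpowWeight_angPart_two_lt_top (h : ctWeightedNorm α σ J v < ⊤) :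
    czNorm α J (rpowWeight σ (angPart 2 v)) < ⊤ :=
  ENNReal.add_lt_top.mpr
    ⟨tailSupNorm_rpowWeight_angPart_two_lt_top h, tailHolderSeminorm_rpowWeight_angPart_two_lt_top h⟩

end Tangential

/-! ### Lemma 3.3: the radial clause `r^{σ+1} v_r ∈ C⁰(M)` -/

section Radial

/-- **The radial derivative `v_r = ∂_r v`** at fixed `p` (`deriv`, junk `0` where not
differentiable); `v_s = -r v_r` (`sDeriv`, print (3.2)). [cite: Ellithy2026, Lemma 3.3 p. 20] -/
def rDeriv (v : ℝ → sphere (0 : E3) 1 → W) : ℝ → sphere (0 : E3) 1 → W :=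
  fun r p ↦ deriv (fun ρ ↦ v ρ p) r

/-- `v_s = -r v_r` (Ellithy 2026, (3.2), p. 20: `∂_s = -r ∂_r`). [cite: Ellithy2026, §3.1 (3.2) p. 20] -/
theorem sDeriv_eq_neg_smul_rDeriv (v : ℝ → sphere (0 : E3) 1 → W) (r : ℝ) (p : sphere (0 : E3) 1) :
    sDeriv v r p = -(r • rDeriv v r p) := rfl

variable {σ : ℝ} {J : Set ℝ} {v : ℝ → sphere (0 : E3) 1 → W}

/-- On `r > 0`, differentiability of `ρ ↦ ρ^σ v(ρ, p)` at `r` gives differentiability of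
`ρ ↦ v(ρ, p)` (divide by the smooth nonvanishing weight). [cite: Ellithy2026, Lemma 3.3 p. 20] -/
theorem differentiableAt_of_rpowWeight {r : ℝ} (hr : 0 < r) {p : sphere (0 : E3) 1}
    (h : DifferentiableAt ℝ (fun ρ ↦ rpowWeight σ v ρ p) r) :
    DifferentiableAt ℝ (fun ρ ↦ v ρ p) r := by
  have hw : DifferentiableAt ℝ (fun ρ : ℝ ↦ ρ ^ (-σ)) r :=
    (Real.hasDerivAt_rpow_const (p := -σ) (Or.inl hr.ne')).differentiableAt
  have h2 : DifferentiableAt ℝ (fun ρ ↦ ρ ^ (-σ) • rpowWeight σ v ρ p) r := hw.smul h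
  refine h2.congr_of_eventuallyEq ?_
  filter_upwards [Ioi_mem_nhds hr] with ρ hρ
  rw [rpowWeight_apply, smul_smul, Real.rpow_neg hρ.le, inv_mul_cancel₀ (Real.rpow_pos_of_pos hρ σ).ne',
    one_smul]

/-- **`-r^{σ+1} v_r = (r^σ v)_s + σ r^σ v`** (Ellithy 2026, proof of Lemma 3.3, p. 20), at `r > 0`
where `v(·, p)` is differentiable. [cite: Ellithy2026, Lemma 3.3 p. 20] -/
theorem rpowWeight_rDeriv_eq {r : ℝ} (hr : 0 < r) {p : sphere (0 : E3) 1}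
    (hd : DifferentiableAt ℝ (fun ρ ↦ v ρ p) r) :
    rpowWeight (σ + 1) (rDeriv v) r p = -(sDeriv (rpowWeight σ v) r p) - σ • rpowWeight σ v r p := by
  have hpow : HasDerivAt (fun ρ : ℝ ↦ ρ ^ σ) (σ * r ^ (σ - 1)) r :=
    Real.hasDerivAt_rpow_const (p := σ) (Or.inl hr.ne')
  have hprod : HasDerivAt (fun ρ ↦ rpowWeight σ v ρ p)
      (r ^ σ • rDeriv v r p + (σ * r ^ (σ - 1)) • v r p) r :=
    hpow.smul hd.hasDerivAt
  have hs : sDeriv (rpowWeight σ v) r p = -(r • (r ^ σ • rDeriv v r p + (σ * r ^ (σ - 1)) • v r p)) := by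
    show -(r • deriv (fun ρ ↦ rpowWeight σ v ρ p) r) = _
    rw [hprod.deriv]
  have h1 : r * r ^ σ = r ^ (σ + 1) := by
    rw [Real.rpow_add hr, Real.rpow_one, mul_comm]
  have h2 : r * (σ * r ^ (σ - 1)) = σ * r ^ σ := by
    have : r ^ (σ - 1) * r = r ^ σ := by
      rw [Real.rpow_sub_one hr.ne', div_mul_cancel₀ _ hr.ne']
    calc r * (σ * r ^ (σ - 1)) = σ * (r ^ (σ - 1) * r) := by ring
      _ = σ * r ^ σ := by rw [this]
  rw [hs, rpowWeight_apply, rpowWeight_apply, smul_add, smul_smul, smul_smul, h1, h2, neg_neg,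
    ← smul_smul σ (r ^ σ) (v r p)]
  abel

/-- **Lemma 3.3, the bound `‖r^{σ+1} v_r‖_{C⁰} ≤ ‖(r^σ v)_s‖_{C⁰} + |σ| ‖r^σ v‖_{C⁰}`** on a tail
`J ⊆ (0, ∞)` on which `r^σ v` satisfies the regularity guard of Def. 3.1 (Ellithy 2026, p. 20).
[cite: Ellithy2026, Lemma 3.3 p. 20] -/
theorem tailSupNorm_rpowWeight_rDeriv_le (hJ : J ⊆ Ioi 0) (hreg : CtRegularOn J (rpowWeight σ v)) :
    tailSupNorm J (rpowWeight (σ + 1) (rDeriv v)) ≤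
      tailSupNorm J (sDeriv (rpowWeight σ v)) + ‖σ‖ₑ * tailSupNorm J (rpowWeight σ v) := by
  refine iSup₂_le fun r hr ↦ iSup_le fun p ↦ ?_
  have hr0 : 0 < r := hJ hr
  have hd : DifferentiableAt ℝ (fun ρ ↦ v ρ p) r := differentiableAt_of_rpowWeight hr0 (hreg.2 r hr p)
  rw [rpowWeight_rDeriv_eq hr0 hd, sub_eq_add_neg]
  calc ‖-sDeriv (rpowWeight σ v) r p + -(σ • rpowWeight σ v r p)‖ₑ
      ≤ ‖-sDeriv (rpowWeight σ v) r p‖ₑ + ‖-(σ • rpowWeight σ v r p)‖ₑ := enorm_add_le _ _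
    _ = ‖sDeriv (rpowWeight σ v) r p‖ₑ + ‖σ‖ₑ * ‖rpowWeight σ v r p‖ₑ := by
        rw [enorm_neg, enorm_neg, enorm_smul]
    _ ≤ tailSupNorm J (sDeriv (rpowWeight σ v)) + ‖σ‖ₑ * tailSupNorm J (rpowWeight σ v) :=
        add_le_add (enorm_le_tailSupNorm J _ hr p)
          (mul_le_mul_of_nonneg_left (enorm_le_tailSupNorm J _ hr p) bot_le)

variable {α : ℝ}

/-- **Lemma 3.3, `r^{σ+1} v_r ∈ C⁰(M)`** on a tail `J ⊆ (0, ∞)` (Ellithy 2026, p. 20).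
[cite: Ellithy2026, Lemma 3.3 p. 20] -/
theorem tailSupNorm_rpowWeight_rDeriv_lt_top (hJ : J ⊆ Ioi 0) (h : ctWeightedNorm α σ J v < ⊤) :
    tailSupNorm J (rpowWeight (σ + 1) (rDeriv v)) < ⊤ := by
  have hreg : CtRegularOn J (rpowWeight σ v) := ctRegularOn_of_ctNorm_lt_top h
  refine lt_of_le_of_lt (tailSupNorm_rpowWeight_rDeriv_le hJ hreg) ?_
  refine ENNReal.add_lt_top.mpr ⟨lt_of_le_of_lt (tailSupNorm_sDeriv_le_ctNorm α J _) h, ?_⟩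
  exact ENNReal.mul_lt_top enorm_lt_top (tailSupNorm_rpowWeight_lt_top h)

/-- **Lemma 3.3 (Ellithy 2026, p. 20), `C⁰` clauses and the tangential Hölder clause**: for
`v ∈ C^{2+α,1+α/2}_{-σ}(M_J)` on a tail `J ⊆ (0, ∞)`: `r^σ v`, `r^σ D̸v`, `r^σ D̸²v`, `r^{σ+1} v_r` are
bounded on `M_J` and `r^σ D̸²v ∈ C^{α,α/2}(M_J)`. (The printed Hölder clause for `r^{σ+1} v_r` needs an
interval tail and `0 < α ≤ 1`: `czNorm_rpowWeight_rDeriv_lt_top`, `lemma33_of_ctWeightedNorm_lt_top`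
below.) [cite: Ellithy2026, Lemma 3.3 p. 20] -/
theorem derivDecay_of_ctWeightedNorm_lt_top (hJ : J ⊆ Ioi 0) (h : ctWeightedNorm α σ J v < ⊤) :
    tailSupNorm J (rpowWeight σ v) < ⊤ ∧
      tailSupNorm J (rpowWeight σ (angPart 1 v)) < ⊤ ∧
      tailSupNorm J (rpowWeight σ (angPart 2 v)) < ⊤ ∧
      tailSupNorm J (rpowWeight (σ + 1) (rDeriv v)) < ⊤ ∧
      czNorm α J (rpowWeight σ (angPart 2 v)) < ⊤ :=
  ⟨tailSupNorm_rpowWeight_lt_top h, tailSupNorm_rpowWeight_angPart_one_lt_top h,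
    tailSupNorm_rpowWeight_angPart_two_lt_top h, tailSupNorm_rpowWeight_rDeriv_lt_top hJ h,
    czNorm_rpowWeight_angPart_two_lt_top h⟩

/-- **Pointwise form of Lemma 3.3's `C⁰` clause for `v` itself**: a finite bound `C` with
`‖v(r, p)‖ ≤ C r^{-σ}` on the tail (`J ⊆ (0, ∞)`) — "the notation `C_{-σ}` corresponds to decay
like `r^{-σ}`" (Def. 3.2, p. 20). [cite: Ellithy2026, Lemma 3.3 p. 20; Def. 3.2 p. 20] -/
theorem exists_norm_le_mul_rpow_neg (hJ : J ⊆ Ioi 0) (h : ctWeightedNorm α σ J v < ⊤) :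
    ∃ C : ℝ, 0 ≤ C ∧ ∀ r ∈ J, ∀ p : sphere (0 : E3) 1, ‖v r p‖ ≤ C * r ^ (-σ) := by
  have hfin := tailSupNorm_rpowWeight_lt_top h
  refine ⟨(tailSupNorm J (rpowWeight σ v)).toReal, ENNReal.toReal_nonneg, fun r hr p ↦ ?_⟩
  have hr0 : 0 < r := hJ hr
  have hle : ‖rpowWeight σ v r p‖ₑ ≤ tailSupNorm J (rpowWeight σ v) := enorm_le_tailSupNorm J _ hr p
  have hle' : ‖rpowWeight σ v r p‖ ≤ (tailSupNorm J (rpowWeight σ v)).toReal := by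
    rw [← ENNReal.ofReal_le_iff_le_toReal hfin.ne, ofReal_norm]
    exact hle
  rw [rpowWeight_apply, norm_smul, Real.norm_eq_abs, abs_of_pos (Real.rpow_pos_of_pos hr0 σ)] at hle'
  have hpos : 0 < r ^ σ := Real.rpow_pos_of_pos hr0 σ
  calc ‖v r p‖ = r ^ (-σ) * (r ^ σ * ‖v r p‖) := by
        rw [Real.rpow_neg hr0.le, ← mul_assoc, inv_mul_cancel₀ hpos.ne', one_mul]
    _ ≤ r ^ (-σ) * (tailSupNorm J (rpowWeight σ v)).toReal :=
        mul_le_mul_of_nonneg_left hle' (Real.rpow_nonneg hr0.le _)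
    _ = (tailSupNorm J (rpowWeight σ v)).toReal * r ^ (-σ) := mul_comm _ _

end Radial

/-! ### Great circles of `S²` and the angular mean value inequality -/

section GreatCircle

/-- The great circle of `S² ⊂ E3` through `p` with initial unit tangent `e ⊥ p`:
`θ ↦ cos θ • p + sin θ • e` (a unit-speed `γ_{S²}`-geodesic). [folklore] -/
def greatCircle (p e : E3) (θ : ℝ) : E3 := Real.cos θ • p + Real.sin θ • e

/-- Velocity of the great circle: `γ'(θ) = -sin θ • p + cos θ • e`. [folklore] -/
private theorem hasDerivAt_greatCircle (p e : E3) (θ : ℝ) :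
    HasDerivAt (greatCircle p e) (-(Real.sin θ) • p + Real.cos θ • e) θ :=
  ((Real.hasDerivAt_cos θ).smul_const p).add ((Real.hasDerivAt_sin θ).smul_const e)

/-- `γ(0) = p`. [folklore] -/
@[simp] private theorem greatCircle_zero (p e : E3) : greatCircle p e 0 = p := by
  simp [greatCircle]

variable {p e : E3}

/-- `‖cos θ • p + sin θ • e‖ = 1` for orthonormal `p, e`. [folklore] -/
private theorem norm_greatCircle (hp : ‖p‖ = 1) (he : ‖e‖ = 1) (hpe : ⟪p, e⟫ = 0) (θ : ℝ) :
    ‖greatCircle p e θ‖ = 1 := by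
  have hsq : ‖greatCircle p e θ‖ ^ 2 = 1 := by
    rw [greatCircle, norm_add_sq_real, norm_smul, norm_smul, hp, he, inner_smul_left,
      inner_smul_right, hpe, Real.norm_eq_abs, Real.norm_eq_abs, mul_one, mul_one, sq_abs, sq_abs]
    simp [Real.cos_sq_add_sin_sq]
  exact (pow_eq_one_iff_of_nonneg (norm_nonneg _) two_ne_zero).mp hsq

/-- The velocity `-sin θ • p + cos θ • e` is a unit vector for orthonormal `p, e`. [folklore] -/
private theorem norm_deriv_greatCircle (hp : ‖p‖ = 1) (he : ‖e‖ = 1) (hpe : ⟪p, e⟫ = 0) (θ : ℝ) :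
    ‖-(Real.sin θ) • p + Real.cos θ • e‖ = 1 := by
  have hsq : ‖-(Real.sin θ) • p + Real.cos θ • e‖ ^ 2 = 1 := by
    rw [norm_add_sq_real, norm_smul, norm_smul, hp, he, inner_smul_left, inner_smul_right, hpe,
      Real.norm_eq_abs, Real.norm_eq_abs, mul_one, mul_one, sq_abs, sq_abs]
    simp [Real.sin_sq_add_cos_sq]
  exact (pow_eq_one_iff_of_nonneg (norm_nonneg _) two_ne_zero).mp hsq

/-- The velocity is tangent: `⟪γ(θ), γ'(θ)⟫ = 0` for orthonormal `p, e`. [folklore] -/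
private theorem inner_greatCircle_deriv (hp : ‖p‖ = 1) (he : ‖e‖ = 1) (hpe : ⟪p, e⟫ = 0) (θ : ℝ) :
    ⟪greatCircle p e θ, -(Real.sin θ) • p + Real.cos θ • e⟫ = 0 := by
  have hep : ⟪e, p⟫ = 0 := by rw [real_inner_comm]; exact hpe
  simp only [greatCircle, inner_add_left, inner_add_right, real_inner_smul_left,
    real_inner_smul_right, real_inner_self_eq_norm_sq, hp, he, hpe, hep]
  ring

end GreatCircle

/-! ### The first covariant derivative controls differences along great circles -/

section AngularMVT

/-- `Π_p X = X - ⟪p, X⟫ p` (unfolding of `sphereTanProj`). [folklore] -/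
private theorem sphereTanProj_apply_eq (p X : E3) : sphereTanProj p X = X - ⟪p, X⟫ • p := by
  simp [sphereTanProj, ContinuousLinearMap.smulRight_apply, innerSL_apply_apply]

/-- `ray y = y` on the unit sphere (`ray : E3 → S²` the radial retraction of the identification
`M ≅ (r₀, ∞) × S²`, Ellithy 2026, §3.1, p. 20). [cite: Ellithy2026, §3.1 p. 20] -/
theorem coe_raySphere_of_norm_eq_one {y : E3} (hy : ‖y‖ = 1) : (raySphere y : E3) = y := by
  have hy0 : y ≠ 0 := by
    intro h; rw [h, norm_zero] at hy; exact zero_ne_one hy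
  simp [raySphere, hy0, hy]

variable {f : sphere (0 : E3) 1 → W}

/-- The order-one angular differentiability guard makes `f ∘ ray` Fréchet differentiable at the
points of the sphere. [cite: Ellithy2026, Def. 3.1 p. 20] -/
theorem differentiableAt_comp_raySphere (q : sphere (0 : E3) 1) (hd : SphereDiffAt 1 f q) :
    DifferentiableAt ℝ (fun y : E3 ↦ f (raySphere y)) (q : E3) := by
  have hG : DifferentiableAt ℝ (fun y : E3 ↦ sphereCovDeriv 0 f (raySphere y)) (q : E3) :=
    hd 0 zero_lt_one
  have hfun : (fun y : E3 ↦ f (raySphere y)) =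
      fun y ↦ sphereCovDeriv 0 f (raySphere y) (Fin.elim0 : Fin 0 → E3) := by
    funext y; rfl
  rw [hfun]
  exact hG.continuousMultilinear_apply_const _

/-- **`|∂_X (f ∘ ray)(q)| ≤ ‖D̸f(q)‖ ‖X‖` for a tangent vector `X ⊥ q`**: the ambient derivative of
`f ∘ ray` along a tangent direction is the covariant derivative `D̸f (q) X` (order one of the Gauss
formula rendering `sphereCovDeriv`). [cite: Ellithy2026, §3.1 p. 20] -/
theorem norm_fderiv_raySphere_le (q : sphere (0 : E3) 1) (hd : SphereDiffAt 1 f q) {X : E3}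
    (hX : ⟪(q : E3), X⟫ = 0) :
    ‖fderiv ℝ (fun y : E3 ↦ f (raySphere y)) (q : E3) X‖ ≤ ‖sphereCovDeriv 1 f q‖ * ‖X‖ := by
  set G : E3 → E3 [×0]→L[ℝ] W := fun y ↦ sphereCovDeriv 0 f (raySphere y) with hG_def
  have hG : DifferentiableAt ℝ G (q : E3) := hd 0 zero_lt_one
  set u0 : Fin 0 → E3 := fun i ↦ sphereTanProj (q : E3) (![X] i.succ) with hu0
  have h1 : fderiv ℝ (fun y : E3 ↦ f (raySphere y)) (q : E3) X = fderiv ℝ G (q : E3) X u0 := by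
    have : (fun y : E3 ↦ f (raySphere y)) = fun y ↦ G y u0 := by
      funext y; rfl
    rw [this, fderiv_continuousMultilinear_apply_const_apply hG]
  have h2 : sphereCovDeriv 1 f q ![X] = fderiv ℝ G (q : E3) X u0 := by
    rw [sphereCovDeriv_succ_apply]
    simp only [Matrix.cons_val_zero]
    rw [sphereTanProj_apply_eq, hX, zero_smul, sub_zero]
  rw [h1, ← h2]
  calc ‖sphereCovDeriv 1 f q ![X]‖ ≤ ‖sphereCovDeriv 1 f q‖ * ∏ i, ‖![X] i‖ :=
        ContinuousMultilinearMap.le_opNorm _ _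
    _ = ‖sphereCovDeriv 1 f q‖ * ‖X‖ := by simp

/-- **Mean value inequality along a great circle**: if `f` is angularly differentiable everywhere
with `‖D̸f‖ ≤ L`, then `‖f(γ(θ₀)) - f(p)‖ ≤ L θ₀` along the unit-speed great circle `γ` from `p`
(`θ₀ ≥ 0` is the `γ_{S²}`-arc length). [folklore] -/
private theorem norm_sub_le_mul_of_greatCircle (hd : ∀ q : sphere (0 : E3) 1, SphereDiffAt 1 f q) {L : ℝ}
    (hL : ∀ q : sphere (0 : E3) 1, ‖sphereCovDeriv 1 f q‖ ≤ L) {p e : E3} (hp : ‖p‖ = 1)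
    (he : ‖e‖ = 1) (hpe : ⟪p, e⟫ = 0) {θ₀ : ℝ} (hθ₀ : 0 ≤ θ₀) :
    ‖f (raySphere (greatCircle p e θ₀)) - f (raySphere p)‖ ≤ L * θ₀ := by
  set F : E3 → W := fun y ↦ f (raySphere y) with hF
  set g : ℝ → W := fun θ ↦ F (greatCircle p e θ) with hg
  have hderiv : ∀ θ : ℝ, HasDerivAt g
      (fderiv ℝ F (greatCircle p e θ) (-(Real.sin θ) • p + Real.cos θ • e)) θ := by
    intro θ
    have hmem : greatCircle p e θ ∈ sphere (0 : E3) 1 :=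
      mem_sphere_zero_iff_norm.mpr (norm_greatCircle hp he hpe θ)
    have hFd : DifferentiableAt ℝ F (greatCircle p e θ) := differentiableAt_comp_raySphere ⟨_, hmem⟩ (hd _)
    exact hFd.hasFDerivAt.comp_hasDerivAt θ (hasDerivAt_greatCircle p e θ)
  have hbound : ∀ θ ∈ Ico (0 : ℝ) θ₀,
      ‖fderiv ℝ F (greatCircle p e θ) (-(Real.sin θ) • p + Real.cos θ • e)‖ ≤ L := by
    intro θ _
    have hmem : greatCircle p e θ ∈ sphere (0 : E3) 1 :=
      mem_sphere_zero_iff_norm.mpr (norm_greatCircle hp he hpe θ)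
    calc ‖fderiv ℝ F (greatCircle p e θ) (-(Real.sin θ) • p + Real.cos θ • e)‖
        ≤ ‖sphereCovDeriv 1 f ⟨_, hmem⟩‖ * ‖-(Real.sin θ) • p + Real.cos θ • e‖ :=
          norm_fderiv_raySphere_le ⟨_, hmem⟩ (hd _) (inner_greatCircle_deriv hp he hpe θ)
      _ ≤ L := by rw [norm_deriv_greatCircle hp he hpe, mul_one]; exact hL _
  have hmvt := norm_image_sub_le_of_norm_deriv_le_segment'
    (fun θ _ ↦ (hderiv θ).hasDerivWithinAt) hbound θ₀ (right_mem_Icc.mpr hθ₀)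
  simpa [hg, hF, greatCircle_zero] using hmvt

/-- **`‖f(p') - f(p)‖ ≤ ‖D̸f‖_{C⁰} · d_{γ_{S²}}(p, p')`** for non-antipodal `p, p'` (great-circle
distance = the angle; the minimising great circle from `p` reaches `p'` at arc length `∠(p, p')`): the
tangential half of the step "is … Hölder whenever `r^σ v` and `(r^σ v)_s` are [bounded with bounded
`D̸`, `∂_s`]" of the proof of Lemma 3.3 (Ellithy 2026, p. 20), for the distance `d_{γ_{S²}}` of the
parabolic metric `d_p` of §3.1. [cite: Ellithy2026, Lemma 3.3 p. 20] -/
theorem norm_sub_le_mul_angle (hd : ∀ q : sphere (0 : E3) 1, SphereDiffAt 1 f q) {L : ℝ}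
    (hL : ∀ q : sphere (0 : E3) 1, ‖sphereCovDeriv 1 f q‖ ≤ L) (p p' : sphere (0 : E3) 1)
    (hπ : InnerProductGeometry.angle (p : E3) (p' : E3) < Real.pi) :
    ‖f p' - f p‖ ≤ L * InnerProductGeometry.angle (p : E3) (p' : E3) := by
  have hp : ‖(p : E3)‖ = 1 := by simp
  have hp' : ‖(p' : E3)‖ = 1 := by simp
  set a := InnerProductGeometry.angle (p : E3) (p' : E3) with ha
  have hcos : Real.cos a = ⟪(p : E3), (p' : E3)⟫ := by
    rw [ha, InnerProductGeometry.cos_angle, hp, hp', mul_one, div_one]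
  have ha0 : 0 ≤ a := InnerProductGeometry.angle_nonneg (p : E3) (p' : E3)
  rcases ha0.eq_or_lt with h0 | h0
  · -- angle = 0: p = p'
    have hinner : ⟪(p : E3), (p' : E3)⟫ = 1 := by rw [← hcos, ← h0, Real.cos_zero]
    have heq : (p : E3) = (p' : E3) := (inner_eq_one_iff_of_norm_eq_one (𝕜 := ℝ) hp hp').mp hinner
    have : p = p' := Subtype.ext heq
    rw [this, sub_self, norm_zero, ← h0, mul_zero]
  · -- 0 < angle < π: follow the great circle from p towards p'
    have hsin : 0 < Real.sin a := Real.sin_pos_of_pos_of_lt_pi h0 hπ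
    set u : E3 := (p' : E3) - Real.cos a • (p : E3) with hu
    have hnu : ‖u‖ = Real.sin a := by
      have hsq : ‖u‖ ^ 2 = Real.sin a ^ 2 := by
        rw [hu, norm_sub_sq_real, norm_smul, hp', hp, inner_smul_right, real_inner_comm, ← hcos,
          Real.norm_eq_abs, mul_one, sq_abs, Real.sin_sq]
        ring
      have := (sq_eq_sq₀ (norm_nonneg u) hsin.le).mp hsq
      exact this
    set e : E3 := (Real.sin a)⁻¹ • u with he_def
    have he : ‖e‖ = 1 := by
      rw [he_def, norm_smul, norm_inv, Real.norm_eq_abs, abs_of_pos hsin, hnu, inv_mul_cancel₀ hsin.ne']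
    have hpe : ⟪(p : E3), e⟫ = 0 := by
      rw [he_def, inner_smul_right, hu, inner_sub_right, inner_smul_right, real_inner_self_eq_norm_sq,
        hp, ← hcos]
      ring
    have hend : greatCircle (p : E3) e a = (p' : E3) := by
      rw [greatCircle, he_def, smul_smul, mul_inv_cancel₀ hsin.ne', one_smul, hu, add_sub_cancel]
    have hmain := norm_sub_le_mul_of_greatCircle hd hL hp he hpe h0.le
    have h1 : raySphere (greatCircle (p : E3) e a) = p' := by
      ext1; rw [hend, coe_raySphere_of_norm_eq_one hp']
    have h2 : raySphere (p : E3) = p := by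
      ext1; exact coe_raySphere_of_norm_eq_one hp
    rwa [h1, h2] at hmain

end AngularMVT

/-! ### The `s`-derivative controls differences along radial segments -/

section RadialMVT

/-- **`‖g(r) - g(r')‖ ≤ ‖g_s‖_{C⁰} |s - s'|`**, `s = -log r`: the mean value inequality in the
logarithmic radial variable on an interval `J ⊆ (0, ∞)` (`g_s = -r g_r`, print (3.2), p. 20) — the
radial half of the step "is … Hölder whenever `r^σ v` and `(r^σ v)_s` are" of the proof of Lemma 3.3
(Ellithy 2026, p. 20), for the summand `|s - s'|^{1/2}` of the parabolic distance `d_p` of §3.1.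
[cite: Ellithy2026, Lemma 3.3 p. 20] -/
theorem norm_sub_le_mul_abs_log_sub {g : ℝ → W} {J : Set ℝ} (hJ : J ⊆ Ioi 0) (hJ' : J.OrdConnected)
    (hd : ∀ ρ ∈ J, DifferentiableAt ℝ g ρ) {K : ℝ} (hK : ∀ ρ ∈ J, ‖ρ • deriv g ρ‖ ≤ K) {r r' : ℝ}
    (hr : r ∈ J) (hr' : r' ∈ J) : ‖g r - g r'‖ ≤ K * |Real.log r - Real.log r'| := by
  -- reduce to r' ≤ r
  wlog hle : r' ≤ r generalizing r r'
  · have h := this hr' hr (not_le.mp hle).le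
    rwa [norm_sub_rev, abs_sub_comm] at h
  have hr0 : 0 < r := hJ hr
  have hr'0 : 0 < r' := hJ hr'
  set a := Real.log r' with ha
  set b := Real.log r with hb
  have hab : a ≤ b := Real.log_le_log hr'0 hle
  set h : ℝ → W := fun u ↦ g (Real.exp u) with hh
  have hmem : ∀ u ∈ Icc a b, Real.exp u ∈ J := by
    intro u hu
    refine hJ'.out hr' hr ⟨?_, ?_⟩
    · calc r' = Real.exp a := by rw [ha, Real.exp_log hr'0]
        _ ≤ Real.exp u := Real.exp_le_exp.mpr hu.1
    · calc Real.exp u ≤ Real.exp b := Real.exp_le_exp.mpr hu.2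
        _ = r := by rw [hb, Real.exp_log hr0]
  have hderiv : ∀ u ∈ Icc a b,
      HasDerivWithinAt h (Real.exp u • deriv g (Real.exp u)) (Icc a b) u := by
    intro u hu
    exact ((hd _ (hmem u hu)).hasDerivAt.scomp u (Real.hasDerivAt_exp u)).hasDerivWithinAt
  have hbound : ∀ u ∈ Ico a b, ‖Real.exp u • deriv g (Real.exp u)‖ ≤ K :=
    fun u hu ↦ hK _ (hmem u (Ico_subset_Icc_self hu))
  have hmvt := norm_image_sub_le_of_norm_deriv_le_segment' hderiv hbound b (right_mem_Icc.mpr hab)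
  have h1 : h b = g r := by simp only [hh, hb, Real.exp_log hr0]
  have h2 : h a = g r' := by simp only [hh, ha, Real.exp_log hr'0]
  rw [h1, h2] at hmvt
  rwa [abs_of_nonneg (sub_nonneg.mpr hab)]

end RadialMVT

/-! ### Interpolation: the Hölder seminorm of `w` from `‖w‖_{C⁰}`, `‖D̸w‖_{C⁰}`, `‖w_s‖_{C⁰}` -/

section Interpolation

variable {α : ℝ} {J : Set ℝ} {w : ℝ → sphere (0 : E3) 1 → W}

omit [NormedSpace ℝ W] in
/-- A uniform bound on the Hölder quotients bounds the seminorm `[u]_{α,α/2;M_J}` (Def. 3.1, p. 20).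
[cite: Ellithy2026, §3.1 p. 20] -/
theorem tailHolderSeminorm_le_of_forall_le {u : ℝ → sphere (0 : E3) 1 → W} {B : ℝ≥0∞}
    (h : ∀ z z' : ℝ × sphere (0 : E3) 1, z.1 ∈ J → z'.1 ∈ J → z ≠ z' →
      ‖u z.1 z.2 - u z'.1 z'.2‖ₑ / ENNReal.ofReal (logParabolicDist z z' ^ α) ≤ B) :
    tailHolderSeminorm α J u ≤ B := by
  unfold tailHolderSeminorm
  exact iSup_le fun z ↦ iSup_le fun z' ↦ iSup_le fun hz ↦ iSup_le fun hz' ↦ iSup_le fun hne ↦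
    h z z' hz hz' hne

omit [NormedSpace ℝ W] in
/-- Real-valued pointwise bound from a finite sup norm. [folklore] -/
private theorem norm_le_toReal_tailSupNorm {u : ℝ → sphere (0 : E3) 1 → W} (hfin : tailSupNorm J u ≠ ⊤)
    {r : ℝ} (hr : r ∈ J) (p : sphere (0 : E3) 1) : ‖u r p‖ ≤ (tailSupNorm J u).toReal := by
  rw [← ENNReal.ofReal_le_iff_le_toReal hfin, ofReal_norm]
  exact enorm_le_tailSupNorm J u hr p

/-- The parabolic distance `d_p((s,x),(s',y)) = d_{γ_{S²}}(x,y) + |s - s'|^{1/2}` (Ellithy 2026, §3.1,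
p. 20) of two distinct points of a tail `J ⊆ (0, ∞)` is positive (`d_{γ_{S²}}` and `s = -log r`
separate points). [cite: Ellithy2026, §3.1 p. 20] -/
theorem logParabolicDist_pos (hJ : J ⊆ Ioi 0) {z z' : ℝ × sphere (0 : E3) 1} (hz : z.1 ∈ J)
    (hz' : z'.1 ∈ J) (hne : z ≠ z') : 0 < logParabolicDist z z' := by
  have h1 := InnerProductGeometry.angle_nonneg (z.2 : E3) (z'.2 : E3)
  have h2 := Real.sqrt_nonneg (|Real.log z.1 - Real.log z'.1|)
  by_contra hle
  have h0 : logParabolicDist z z' = 0 :=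
    le_antisymm (not_lt.mp hle) (add_nonneg h1 h2)
  have hang : InnerProductGeometry.angle (z.2 : E3) (z'.2 : E3) = 0 := by
    unfold logParabolicDist at h0; linarith
  have hsqrt : Real.sqrt |Real.log z.1 - Real.log z'.1| = 0 := by
    unfold logParabolicDist at h0; linarith
  have hp : ‖(z.2 : E3)‖ = 1 := by simp
  have hp' : ‖(z'.2 : E3)‖ = 1 := by simp
  have hcos : Real.cos (InnerProductGeometry.angle (z.2 : E3) (z'.2 : E3)) = ⟪(z.2 : E3), (z'.2 : E3)⟫ := by
    rw [InnerProductGeometry.cos_angle, hp, hp', mul_one, div_one]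
  have heq2 : z.2 = z'.2 := by
    ext1
    refine (inner_eq_one_iff_of_norm_eq_one (𝕜 := ℝ) hp hp').mp ?_
    rw [← hcos, hang, Real.cos_zero]
  have habs : |Real.log z.1 - Real.log z'.1| = 0 :=
    le_antisymm (Real.sqrt_eq_zero'.mp hsqrt) (abs_nonneg _)
  have heq1 : z.1 = z'.1 :=
    Real.log_injOn_pos (hJ hz) (hJ hz') (sub_eq_zero.mp (abs_eq_zero.mp habs))
  exact hne (Prod.ext heq1 heq2)

/-- **Interpolation inequality** `[w]_{α,α/2;M_J} ≤ ‖D̸w‖_{C⁰} + ‖w_s‖_{C⁰} + 2‖w‖_{C⁰}` on an interval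
`J ⊆ (0, ∞)`, `0 < α ≤ 1`, for `w` satisfying the regularity guard of Def. 3.1: pairs at parabolic
distance `d_p ≥ 1` are controlled by `2‖w‖_{C⁰}`, pairs with `d_p < 1` by the mean value inequality
along the great circle (`‖D̸w‖_{C⁰} d_{γ_{S²}}`) and along the radial segment in `s = -log r`
(`‖w_s‖_{C⁰} |s - s'| ≤ ‖w_s‖_{C⁰} |s - s'|^{1/2}`), and `d_p ≤ d_p^α`.  This is the step "is …
Hölder whenever `r^σ v` and `(r^σ v)_s` are" of the proof of Lemma 3.3 (Ellithy 2026, p. 20), the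
Hölder seminorm of the function itself not being a summand of the `C^{2+α,1+α/2}` norm of Def. 3.1.
[cite: Ellithy2026, Lemma 3.3 p. 20] -/
theorem tailHolderSeminorm_le_interpolation (hJ : J ⊆ Ioi 0) (hJ' : J.OrdConnected) (hα : 0 < α)
    (hα1 : α ≤ 1) (hreg : CtRegularOn J w) :
    tailHolderSeminorm α J w ≤
      tailSupNorm J (angPart 1 w) + tailSupNorm J (sDeriv w) + 2 * tailSupNorm J w := by
  set A := tailSupNorm J (angPart 1 w) with hA_def
  set S := tailSupNorm J (sDeriv w) with hS_def
  set M := tailSupNorm J w with hM_def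
  by_cases hA : A = ⊤
  · rw [hA, top_add, top_add]; exact le_top
  by_cases hS : S = ⊤
  · rw [hS, add_top, top_add]; exact le_top
  by_cases hM : M = ⊤
  · rw [hM, ENNReal.mul_top two_ne_zero, add_top]; exact le_top
  -- real-valued bounds
  have hAb : ∀ r ∈ J, ∀ q : sphere (0 : E3) 1, ‖sphereCovDeriv 1 (w r) q‖ ≤ A.toReal :=
    fun r hr q ↦ norm_le_toReal_tailSupNorm hA hr q
  have hSb : ∀ p : sphere (0 : E3) 1, ∀ ρ ∈ J, ‖ρ • deriv (fun ρ' ↦ w ρ' p) ρ‖ ≤ S.toReal := by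
    intro p ρ hρ
    have h := norm_le_toReal_tailSupNorm hS hρ p
    rwa [sDeriv, norm_neg] at h
  have hMb : ∀ r ∈ J, ∀ q : sphere (0 : E3) 1, ‖w r q‖ ≤ M.toReal :=
    fun r hr q ↦ norm_le_toReal_tailSupNorm hM hr q
  have hB : A + S + 2 * M = ENNReal.ofReal (A.toReal + S.toReal + 2 * M.toReal) := by
    rw [ENNReal.ofReal_add (by positivity) (by positivity), ENNReal.ofReal_add (by positivity)
      (by positivity), ENNReal.ofReal_mul zero_le_two, ENNReal.ofReal_toReal hA,
      ENNReal.ofReal_toReal hS, ENNReal.ofReal_toReal hM, ENNReal.ofReal_ofNat]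
  rw [hB]
  set B : ℝ := A.toReal + S.toReal + 2 * M.toReal with hB_def
  have hB0 : 0 ≤ B := by positivity
  refine tailHolderSeminorm_le_of_forall_le fun z z' hz hz' hne ↦ ?_
  obtain ⟨r, p⟩ := z
  obtain ⟨r', p'⟩ := z'
  simp only at hz hz' ⊢
  set d := logParabolicDist (r, p) (r', p') with hd_def
  have hd0 : 0 < d := logParabolicDist_pos hJ hz hz' hne
  refine ENNReal.div_le_of_le_mul ?_
  rw [← ofReal_norm, ← ENNReal.ofReal_mul hB0]
  refine ENNReal.ofReal_le_ofReal ?_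
  -- the real inequality `‖w r p - w r' p'‖ ≤ B * d ^ α`
  rcases le_or_gt 1 d with h1d | hd1
  · -- far pairs: `2 ‖w‖_{C⁰}`
    calc ‖w r p - w r' p'‖ ≤ ‖w r p‖ + ‖w r' p'‖ := norm_sub_le _ _
      _ ≤ M.toReal + M.toReal := add_le_add (hMb r hz p) (hMb r' hz' p')
      _ = 2 * M.toReal := by ring
      _ ≤ B * 1 := by rw [mul_one, hB_def]; nlinarith [ENNReal.toReal_nonneg (a := A), ENNReal.toReal_nonneg (a := S)]
      _ ≤ B * d ^ α := mul_le_mul_of_nonneg_left (Real.one_le_rpow h1d hα.le) hB0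
  · -- close pairs: angular + radial mean value inequalities
    have hang_le : InnerProductGeometry.angle (p : E3) (p' : E3) ≤ d := by
      rw [hd_def, logParabolicDist]; exact le_add_of_nonneg_right (Real.sqrt_nonneg _)
    have hsqrt_le : Real.sqrt |Real.log r - Real.log r'| ≤ d := by
      rw [hd_def, logParabolicDist]
      exact le_add_of_nonneg_left (InnerProductGeometry.angle_nonneg _ _)
    have hπ : InnerProductGeometry.angle (p : E3) (p' : E3) < Real.pi :=
      lt_of_le_of_lt hang_le (hd1.trans_le (by linarith [Real.two_le_pi]))
    set t := |Real.log r - Real.log r'| with ht_def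
    have ht0 : 0 ≤ t := abs_nonneg _
    have hst1 : Real.sqrt t < 1 := lt_of_le_of_lt hsqrt_le hd1
    have ht_le : t ≤ d := by
      have hs0 : 0 ≤ Real.sqrt t := Real.sqrt_nonneg t
      have hts : t ≤ Real.sqrt t :=
        calc t = Real.sqrt t * Real.sqrt t := (Real.mul_self_sqrt ht0).symm
          _ ≤ Real.sqrt t * 1 := mul_le_mul_of_nonneg_left hst1.le hs0
          _ = Real.sqrt t := mul_one _
      exact hts.trans hsqrt_le
    -- angular piece
    have hang : ‖w r p' - w r p‖ ≤ A.toReal * InnerProductGeometry.angle (p : E3) (p' : E3) :=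
      norm_sub_le_mul_angle (fun q j hj ↦ hreg.1 r hz q j (by omega)) (hAb r hz) p p' hπ
    -- radial piece
    have hrad : ‖w r p' - w r' p'‖ ≤ S.toReal * t :=
      norm_sub_le_mul_abs_log_sub hJ hJ' (fun ρ hρ ↦ hreg.2 ρ hρ p') (hSb p') hz hz'
    have hdd : d ≤ d ^ α := by
      have := Real.rpow_le_rpow_of_exponent_ge hd0 hd1.le hα1
      rwa [Real.rpow_one] at this
    calc ‖w r p - w r' p'‖ ≤ ‖w r p - w r p'‖ + ‖w r p' - w r' p'‖ := norm_sub_le_norm_sub_add_norm_sub _ _ _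
      _ ≤ A.toReal * InnerProductGeometry.angle (p : E3) (p' : E3) + S.toReal * t := by
          rw [norm_sub_rev]; exact add_le_add hang hrad
      _ ≤ A.toReal * d + S.toReal * d :=
          add_le_add (mul_le_mul_of_nonneg_left hang_le ENNReal.toReal_nonneg)
            (mul_le_mul_of_nonneg_left ht_le ENNReal.toReal_nonneg)
      _ ≤ B * d := by
          rw [hB_def]; nlinarith [ENNReal.toReal_nonneg (a := M)]
      _ ≤ B * d ^ α := mul_le_mul_of_nonneg_left hdd hB0

/-- **`[w]_{α,α/2} < ∞` for `w ∈ C^{2+α,1+α/2}(M_J)`** (interval `J ⊆ (0, ∞)`, `0 < α ≤ 1`): the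
function itself is parabolically Hölder (interpolation, `tailHolderSeminorm_le_interpolation`).
[cite: Ellithy2026, Lemma 3.3 p. 20] -/
theorem tailHolderSeminorm_lt_top_of_ctNorm_lt_top (hJ : J ⊆ Ioi 0) (hJ' : J.OrdConnected)
    (hα : 0 < α) (hα1 : α ≤ 1) (h : ctNorm α J w < ⊤) : tailHolderSeminorm α J w < ⊤ := by
  have hreg : CtRegularOn J w := ctRegularOn_of_ctNorm_lt_top h
  refine lt_of_le_of_lt (tailHolderSeminorm_le_interpolation hJ hJ' hα hα1 hreg) ?_
  refine ENNReal.add_lt_top.mpr ⟨ENNReal.add_lt_top.mpr ⟨?_, ?_⟩, ?_⟩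
  · exact lt_of_le_of_lt (tailSupNorm_angPart_one_le_ctNorm α J w) h
  · exact lt_of_le_of_lt (tailSupNorm_sDeriv_le_ctNorm α J w) h
  · exact ENNReal.mul_lt_top ENNReal.ofNat_lt_top (lt_of_le_of_lt (tailSupNorm_le_ctNorm α J w) h)

/-- With the `C⁰` norm: `‖w‖_{C^{α,α/2}(M_J)} < ∞` for `w ∈ C^{2+α,1+α/2}(M_J)`.
[cite: Ellithy2026, Lemma 3.3 p. 20] -/
theorem czNorm_lt_top_of_ctNorm_lt_top (hJ : J ⊆ Ioi 0) (hJ' : J.OrdConnected) (hα : 0 < α)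
    (hα1 : α ≤ 1) (h : ctNorm α J w < ⊤) : czNorm α J w < ⊤ :=
  ENNReal.add_lt_top.mpr
    ⟨lt_of_le_of_lt (tailSupNorm_le_ctNorm α J w) h, tailHolderSeminorm_lt_top_of_ctNorm_lt_top hJ hJ' hα hα1 h⟩

end Interpolation

/-! ### Lemma 3.3: the radial Hölder clause `r^{σ+1} v_r ∈ C^{α,α/2}(M)` -/

section RadialHolder

variable {α σ : ℝ} {J : Set ℝ} {v : ℝ → sphere (0 : E3) 1 → W}

/-- **Lemma 3.3, Hölder level, `r^σ v ∈ C^{α,α/2}(M)`** (implicit in the printed proof: "`… is bounded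
and Hölder whenever r^σ v and (r^σ v)_s are`", Ellithy 2026, p. 20), interval `J ⊆ (0, ∞)`, `0 < α ≤ 1`.
[cite: Ellithy2026, Lemma 3.3 p. 20] -/
theorem czNorm_rpowWeight_lt_top (hJ : J ⊆ Ioi 0) (hJ' : J.OrdConnected) (hα : 0 < α)
    (hα1 : α ≤ 1) (h : ctWeightedNorm α σ J v < ⊤) : czNorm α J (rpowWeight σ v) < ⊤ :=
  czNorm_lt_top_of_ctNorm_lt_top hJ hJ' hα hα1 h

/-- **`[r^{σ+1} v_r]_{α,α/2} ≤ [(r^σ v)_s]_{α,α/2} + |σ| [r^σ v]_{α,α/2}`** on a tail `J ⊆ (0, ∞)` on which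
`r^σ v` satisfies the regularity guard of Def. 3.1 — from the identity
`-r^{σ+1} v_r = (r^σ v)_s + σ r^σ v` of the proof of Lemma 3.3 (Ellithy 2026, p. 20).
[cite: Ellithy2026, Lemma 3.3 p. 20] -/
theorem tailHolderSeminorm_rpowWeight_rDeriv_le (hJ : J ⊆ Ioi 0)
    (hreg : CtRegularOn J (rpowWeight σ v)) :
    tailHolderSeminorm α J (rpowWeight (σ + 1) (rDeriv v)) ≤
      tailHolderSeminorm α J (sDeriv (rpowWeight σ v))
        + ‖σ‖ₑ * tailHolderSeminorm α J (rpowWeight σ v) := by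
  set w := rpowWeight σ v with hw
  refine tailHolderSeminorm_le_of_forall_le fun z z' hz hz' hne ↦ ?_
  have hd : ∀ {r : ℝ}, r ∈ J → ∀ p : sphere (0 : E3) 1, DifferentiableAt ℝ (fun ρ ↦ v ρ p) r :=
    fun hr p ↦ differentiableAt_of_rpowWeight (hJ hr) (hreg.2 _ hr p)
  rw [rpowWeight_rDeriv_eq (hJ hz) (hd hz z.2), rpowWeight_rDeriv_eq (hJ hz') (hd hz' z'.2)]
  set D := ENNReal.ofReal (logParabolicDist z z' ^ α) with hD
  have halg : -sDeriv w z.1 z.2 - σ • w z.1 z.2 - (-sDeriv w z'.1 z'.2 - σ • w z'.1 z'.2) =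
      -(sDeriv w z.1 z.2 - sDeriv w z'.1 z'.2) - σ • (w z.1 z.2 - w z'.1 z'.2) := by
    rw [smul_sub]; abel
  rw [halg]
  calc ‖-(sDeriv w z.1 z.2 - sDeriv w z'.1 z'.2) - σ • (w z.1 z.2 - w z'.1 z'.2)‖ₑ / D
      ≤ (‖-(sDeriv w z.1 z.2 - sDeriv w z'.1 z'.2)‖ₑ + ‖σ • (w z.1 z.2 - w z'.1 z'.2)‖ₑ) / D := by
        gcongr; exact enorm_sub_le
    _ = ‖sDeriv w z.1 z.2 - sDeriv w z'.1 z'.2‖ₑ / D + ‖σ‖ₑ * (‖w z.1 z.2 - w z'.1 z'.2‖ₑ / D) := by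
        rw [ENNReal.add_div, enorm_neg, enorm_smul, mul_div_assoc]
    _ ≤ tailHolderSeminorm α J (sDeriv w) + ‖σ‖ₑ * tailHolderSeminorm α J w :=
        add_le_add (holderQuotient_le_tailHolderSeminorm α J _ hz hz' hne)
          (mul_le_mul_of_nonneg_left (holderQuotient_le_tailHolderSeminorm α J _ hz hz' hne) bot_le)

/-- **Lemma 3.3, Hölder level, `r^{σ+1} v_r ∈ C^{α,α/2}(M)`: the seminorm** `[r^{σ+1} v_r]_{α,α/2;M_J} < ∞`
for `v ∈ C^{2+α,1+α/2}_{-σ}(M_J)` on an interval `J ⊆ (0, ∞)`, `0 < α ≤ 1` (Ellithy 2026, p. 20).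
[cite: Ellithy2026, Lemma 3.3 p. 20] -/
theorem tailHolderSeminorm_rpowWeight_rDeriv_lt_top (hJ : J ⊆ Ioi 0) (hJ' : J.OrdConnected)
    (hα : 0 < α) (hα1 : α ≤ 1) (h : ctWeightedNorm α σ J v < ⊤) :
    tailHolderSeminorm α J (rpowWeight (σ + 1) (rDeriv v)) < ⊤ := by
  have hreg : CtRegularOn J (rpowWeight σ v) := ctRegularOn_of_ctNorm_lt_top h
  refine lt_of_le_of_lt (tailHolderSeminorm_rpowWeight_rDeriv_le hJ hreg) ?_
  refine ENNReal.add_lt_top.mpr ⟨lt_of_le_of_lt (tailHolderSeminorm_sDeriv_le_ctNorm α J _) h, ?_⟩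
  exact ENNReal.mul_lt_top enorm_lt_top (tailHolderSeminorm_lt_top_of_ctNorm_lt_top hJ hJ' hα hα1 h)

/-- **Lemma 3.3, Hölder level, `r^{σ+1} v_r ∈ C^{α,α/2}(M)`** (`C⁰` norm plus seminorm finite) for
`v ∈ C^{2+α,1+α/2}_{-σ}(M_J)`, interval `J ⊆ (0, ∞)`, `0 < α ≤ 1` (Ellithy 2026, p. 20).
[cite: Ellithy2026, Lemma 3.3 p. 20] -/
theorem czNorm_rpowWeight_rDeriv_lt_top (hJ : J ⊆ Ioi 0) (hJ' : J.OrdConnected) (hα : 0 < α)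
    (hα1 : α ≤ 1) (h : ctWeightedNorm α σ J v < ⊤) :
    czNorm α J (rpowWeight (σ + 1) (rDeriv v)) < ⊤ :=
  ENNReal.add_lt_top.mpr
    ⟨tailSupNorm_rpowWeight_rDeriv_lt_top hJ h, tailHolderSeminorm_rpowWeight_rDeriv_lt_top hJ hJ' hα hα1 h⟩

/-- **Lemma 3.3 (Ellithy 2026, p. 20), complete**: "Let `σ ∈ ℝ` and `v ∈ C^{2+α,1+α/2}_{-σ}(M)`. Then
`r^σ v, r^σ D̸v, r^σ D̸²v ∈ C⁰(M)`, `r^{σ+1} v_r ∈ C⁰(M)`, and likewise at the Hölder level,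
`r^σ D̸²v ∈ C^{α,α/2}(M)`, `r^{σ+1} v_r ∈ C^{α,α/2}(M)`" — for the typed spaces on an interval tail
`J ⊆ (0, ∞)` (the print's `M_{r_*,R} = (r_*, R] × S²`) and `0 < α ≤ 1` (the print's `α ∈ (0,1)`).
[cite: Ellithy2026, Lemma 3.3 p. 20] -/
theorem lemma33_of_ctWeightedNorm_lt_top (hJ : J ⊆ Ioi 0) (hJ' : J.OrdConnected) (hα : 0 < α)
    (hα1 : α ≤ 1) (h : ctWeightedNorm α σ J v < ⊤) :
    tailSupNorm J (rpowWeight σ v) < ⊤ ∧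
      tailSupNorm J (rpowWeight σ (angPart 1 v)) < ⊤ ∧
      tailSupNorm J (rpowWeight σ (angPart 2 v)) < ⊤ ∧
      tailSupNorm J (rpowWeight (σ + 1) (rDeriv v)) < ⊤ ∧
      czNorm α J (rpowWeight σ (angPart 2 v)) < ⊤ ∧
      czNorm α J (rpowWeight (σ + 1) (rDeriv v)) < ⊤ :=
  ⟨tailSupNorm_rpowWeight_lt_top h, tailSupNorm_rpowWeight_angPart_one_lt_top h,
    tailSupNorm_rpowWeight_angPart_two_lt_top h, tailSupNorm_rpowWeight_rDeriv_lt_top hJ h,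
    czNorm_rpowWeight_angPart_two_lt_top h, czNorm_rpowWeight_rDeriv_lt_top hJ hJ' hα hα1 h⟩

/-- Lemma 3.3 on the fixed open tails `M_{r₁,∞} = (r₁, ∞) × S²`, `r₁ ≥ 0`, of Defs. 3.6–3.29
(Ellithy 2026, pp. 21–34). [cite: Ellithy2026, Lemma 3.3 p. 20] -/
theorem lemma33_Ioi {r₁ : ℝ} (hr₁ : 0 ≤ r₁) (hα : 0 < α) (hα1 : α ≤ 1)
    (h : ctWeightedNorm α σ (Ioi r₁) v < ⊤) :
    tailSupNorm (Ioi r₁) (rpowWeight σ v) < ⊤ ∧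
      tailSupNorm (Ioi r₁) (rpowWeight σ (angPart 1 v)) < ⊤ ∧
      tailSupNorm (Ioi r₁) (rpowWeight σ (angPart 2 v)) < ⊤ ∧
      tailSupNorm (Ioi r₁) (rpowWeight (σ + 1) (rDeriv v)) < ⊤ ∧
      czNorm α (Ioi r₁) (rpowWeight σ (angPart 2 v)) < ⊤ ∧
      czNorm α (Ioi r₁) (rpowWeight (σ + 1) (rDeriv v)) < ⊤ :=
  lemma33_of_ctWeightedNorm_lt_top (Ioi_subset_Ioi hr₁) ordConnected_Ioi hα hα1 h

end RadialHolder

end Literature.Geometry.Lorentzian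

end
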